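import Summits.HodgeConjecture.HodgeConjecture.Theorems.MarkmanPartnerTransportRMTypeDefs

/-!
# Route MarkmanPartnerTransport · cruxes `PicardThreeK3Squares` (stmt-HodgeConjecture-19652) and
# `LowPicardRealMultiplication` (stmt-HodgeConjecture-19653) — the displayed input `RMTypeOpen θ`
# («a cycle for `θ` on an OPEN SET of its Hodge locus»), one definition

Cell hodge-nonav, crux #4 (HC⁴(S ⊗ S), ρ(S) ≥ 3; open core: real multiplication), programme «RATIONAL ORBIT
DENSITY» (prover seat hodge-nonav-19652-p1 gen 10). The cell's RM-type descent
(`RMTypeDescent.hodgeConjectureFor_square_of_rmTypeDominated`, p620943) consumes the displayed moduli input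
`RMTypeDominated θ` of `…RMTypeDefs`: an `RMSpreadFamily` — hence an algebraic cycle inducing `θ` — at EVERY
marked projective K3 surface whose period is a `θ`-generic `θ_ℂ`-eigenvector; its intended discharge needs
the universal family over the real-multiplication component and Deligne's invariant-cycle theorem (moduli
carriers the tree does not have). Since the rational centraliser `G_θ(ℚ) = {g ∈ O(Λ_ℚ) : gθ = θg}` has DENSE
orbits on each Hodge locus `D_{θ,e} = {y : θ_ℂ y = e y, (y.y) = 0, (ȳ.y) > 0}` (tree theorem
`RMTypeOrbit.exists_ratIsometry_commute_smul_mem_of_isOpen`, fact-free) and cycle-inducedness of `θ` moves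
along `G_θ(ℚ)` by Buskin transport, the input can be WEAKENED to:

* `RMTypeOpen θ` — **for every eigenvalue `e` whose Hodge locus `D_{θ,e}` contains a `θ`-generic period
  point, there is an OPEN `U ⊂ Λ_ℂ` meeting `D_{θ,e}` such that every marked projective K3 surface
  `(S', η', p', y)` (the crux's `MarkedK3` binder, verbatim) with period `y ∈ U` a `θ`-generic
  `e`-eigenvector of `θ_ℂ` carries an algebraic class `γ' ∈ N²H⁴(S' × S')` inducing `η'⁻¹ ∘ θ_ℂ ∘ η'`
  as the correspondence `z ↦ pr₁_*(pr₂^* z ∪ γ')`** (the cycle clause is VERBATIM the conclusion of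
  `RMSpreadFamily.exists_algebraicClass'`).

`RMTypeDominated θ → RMTypeOpen θ` (for `θ` self-adjoint; `U = Λ_ℂ`) and the consumer
`hodgeConjectureFor_square_of_rmTypeOpen` are proved in `…PicardThreeK3SquaresRMTypeOpenDescent`.
Intended discharge (NOT in the tree; no elliptic-K3 ∕ Weierstrass carriers): for a MAXIMAL van Geemen–Schütt
family (Forum Math. Sigma 13 (2025) e2, Thm. 1.1 (9) ζ₉⁺ at ρ = 10, Thm. 1.1 (11) ζ₁₁⁺ at ρ = 2, Thm. 1.2 (2)
√2 at ρ = 10) with model endomorphism `θ`: `U` = the cone over the period image of the family (open by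
maximality = `l − 2` effective moduli and local Torelli), the cycle = `Γ₁ + Γ₋₁` resp. the graph of the
self-map on EVERY member (§4.8, §6.4) — no universal family, no flat section, no monodromy argument.
One definition, nothing asserted, no instance, no sorry; not claimed to hold for any `θ ≠ 0`. With the cycle
clause the Prop is implied by the Hodge conjecture for K3 squares and cannot be refuted short of refuting it.
Prover seat hodge-nonav-19652-p1 (gen 10), `--supports stmt-HodgeConjecture-19652`.

References: van Geemen–Schütt, Forum Math. Sigma 13 (2025) e2, §3.4, Thm. 1.1 (9), (11), Thm. 1.2 (2),
§4.8, §6.4; Huybrechts, *Lectures on K3 Surfaces*, Ch. 6 Prop. 1.5, Rem. 3.3 and §4.2; Buskin, J. reine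
angew. Math. 755 (2019), Thm. 1.1; O'Meara, *Introduction to Quadratic Forms*, §42–§43B.
-/

set_option linter.dupNamespace false

noncomputable section

namespace Summit.HodgeConjecture.HodgeConjecture.Theorems.MarkmanPartnerTransport

open CategoryTheory MonoidalCategory
open Literature.AlgebraicGeometry Literature.AlgebraicGeometry.Motives Literature.AlgebraicGeometry.HodgeTheory
open Literature.AlgebraicGeometry.Surfaces
open Literature.AlgebraicTopology.SingularHomology

/-- `MarkedK3[S, η, p, x]`: VERBATIM the `let MarkedK3 := …` binder of the route declaration
`PicardThreeK3Squares` (as in `…RMTypeDefs`). Local notation only. -/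
local notation3 (prettyPrint := false) "MarkedK3[" S ", " η ", " p ", " x "]" =>
  (p ≠ 0 ∧ (IsIntegralClass p ∧
    (∀ q : complexBetti S (2 * 2), IsIntegralClass q → ∃ n : ℤ, q = n • p) ∧
    (∀ c : complexBetti S (2 * 1), IsIntegralClass c ↔ ∃ v : K3Index → ℤ, η c = fun i => (v i : ℂ)) ∧
    (∀ a b : complexBetti S (2 * 1),
      cupProduct (rfl : 2 * 1 + 2 * 1 = 2 * 2) a b = k3Form (η a) (η b) • p) ∧
    IsOfHodgeType 2 S (2 * 1) 2 0 (LinearEquiv.symm η x) ∧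
    (∀ τ : complexBetti S (2 * 1), IsOfHodgeType 2 S (2 * 1) 2 0 τ →
      ∃ t : ℂ, τ = t • LinearEquiv.symm η x)) ∧
    (k3Form x x = 0 ∧ 0 < (k3Form (star x) x).re ∧
      ∃ u : K3Index → ℤ, k3Form (fun i => (u i : ℂ)) x = 0 ∧ 0 < ∑ i, ∑ j, u i * k3Gram i j * u j))

/-- **(O) the displayed open-set input, one per RATIONAL real-multiplication type** (programme «RATIONAL
ORBIT DENSITY»; weaker than `RMTypeDominated θ`). For every `e ∈ ℂ` such that the Hodge locus `D_{θ,e}`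
contains a `θ`-generic period point `y₀` (`θ_ℂ y₀ = e y₀`, `(y₀.y₀) = 0`, `(ȳ₀.y₀) > 0`, every rational
vector orthogonal to `y₀` killed by `θ`), there is an open `U ⊂ Λ_ℂ` containing a period point of
`D_{θ,e}` such that every marked projective K3 surface `(S', η', p', y)` with `y ∈ U` a `θ`-generic
`e`-eigenvector of `θ_ℂ` admits an algebraic class `γ'` on `S' × S'` inducing `η'⁻¹ ∘ θ_ℂ ∘ η'` as the
correspondence `pr₁_*(pr₂^*(–) ∪ γ')` (complex orientations). Intended discharge: maximal van
Geemen–Schütt families (period image with non-empty interior; cycle `Γ₁ + Γ₋₁` on every member). Not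
claimed to hold for any `θ ≠ 0`. [cite: GeemenSchutt2023, §3.4, Thm. 1.1 (9), (11), Thm. 1.2 (2) and §4.8]
[cite: Huybrechts2016K3, Ch. 6 Prop. 1.5 and Rem. 3.3] [cite: Buskin2019, Thm. 1.1] -/
def RMTypeOpen (θ : Matrix K3Index K3Index ℚ) : Prop :=
  ∀ (e : ℂ) (y₀ : K3Index → ℂ), thetaC θ y₀ = e • y₀ → k3Form y₀ y₀ = 0 → 0 < (k3Form (star y₀) y₀).re →
    (∀ v : K3Index → ℚ, k3Form (fun i => (v i : ℂ)) y₀ = 0 → θ.mulVec v = 0) →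
    ∃ U : Set (K3Index → ℂ), IsOpen U ∧
      (∃ y₁ ∈ U, thetaC θ y₁ = e • y₁ ∧ k3Form y₁ y₁ = 0 ∧ 0 < (k3Form (star y₁) y₁).re) ∧
      ∀ (S' : SchemeOver ℂ) (hS' : IsK3Surface S') (η' : complexBetti S' (2 * 1) ≃ₗ[ℂ] (K3Index → ℂ))
        (p' : complexBetti S' (2 * 2)) (y : K3Index → ℂ), y ∈ U → MarkedK3[S', η', p', y] →
        thetaC θ y = e • y →
        (∀ v : K3Index → ℚ, k3Form (fun i => (v i : ℂ)) y = 0 → θ.mulVec v = 0) →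
        ∃ γ' ∈ algebraicClasses (S' ⊗ S') 2, ∀ z : complexBetti S' (2 * 1),
          (η'.symm.toLinearMap ∘ₗ (thetaC θ ∘ₗ η'.toLinearMap)) z =
            complexGysin complexOrientationFamily
              (IsSmoothProjective.tensor_holds hS'.isSmoothProjective hS'.isSmoothProjective)
              hS'.isSmoothProjective (SemiCartesianMonoidalCategory.fst S' S')
              (rfl : 2 * 1 + 2 * 2 + 2 * 2 = 2 * 1 + 2 * (2 + 2))
              (cupProduct (rfl : 2 * 1 + 2 * 2 = 2 * 1 + 2 * 2)
                (complexBetti.map (SemiCartesianMonoidalCategory.snd S' S') (2 * 1) z) γ')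


end Summit.HodgeConjecture.HodgeConjecture.Theorems.MarkmanPartnerTransport

end
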